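import Summits.QuantumAdvantage.QuantumAdvantage.Theorems.CubicForrelationNearExactIsExactCubicFormHalves
import Summits.QuantumAdvantage.QuantumAdvantage.Theorems.CubicForrelationNearExactIsExactCubicFormSymplecticCoords

/-!
# Crux `CubicForrelation.NearExactIsExact` (stmt-QuantumAdvantage-14043) — the two halves when `rank ω = 4` (cell lemma L2 for `s₀ω₄`):
  `β ∈ {0, ω₄}` or BOTH halves have rank 2 (the family `R`)

Certificate seat `b2b-cforr-cert` (gen 41).  HONEST FRAMING: kernel-checked assembly (standard axioms) of …CubicFormHalves (`tcl_halves_rank`)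
and …CubicFormSymplecticCoords (`tsc_form_expansion`): E1280-HANDPROOFS App. A.4 with `μ = 2` — for two quadratics `f₀, f₁` on `𝔽₂⁸` whose
forms differ by a form `ω` with a maximal frame of size `2` (`s₀ω₄`): if `#f₀ + #f₁ < 160` then `B₀ ≡ 0`, or `B₁ ≡ 0`, or both `B₀` and `B₁`
have rank `2`, i.e. `Bᵢ(x,y) = pᵢ(x)qᵢ(y) ⊕ qᵢ(x)pᵢ(y)` (the case "R" of the `s₀ω₄` leaves, …TwelvePartnerR2LeafW4a/b); and if
`#f₀ + #f₁ < 192` then one of them has rank `≤ 2`.  Nothing about `θ₁₂`; NOT summit progress.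

* `tcl_rank_one_product`: a maximal frame of size `1` makes `B` a product form `p ∧ q`.
* `tcl_halves_eight_mu2` (**main**), `tcl_halves_eight_mu2_weak` (`< 192`).

References: E1280-HANDPROOFS.md App. A.4; F. J. MacWilliams, N. J. A. Sloane (1977) Ch. 15 §2.  Axioms: the standard three.
-/

set_option linter.dupNamespace false -- D-0017: single-problem summit ⇒ `QuantumAdvantage.QuantumAdvantage` by design

namespace Summit.QuantumAdvantage.QuantumAdvantage.Theorems.CubicForrelation.NearExactIsExact

open Finset
open Literature.Computability.QuantumComplexity.BuzetChailloux (bxor zeroVec bxor_comm bxor_self bxor_zeroVec zeroVec_bxor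
  bxor_bxor_cancel_left)

variable {n : ℕ}

/-- **Rank 2 = product form.**  A symmetric first-slot-additive form with a maximal frame `(b₀, c₀)` of size `1` is
`B(x,y) = B(x,c₀)B(y,b₀) ⊕ B(x,b₀)B(y,c₀)`. [folklore] -/
theorem tcl_rank_one_product (B : (Fin n → Bool) → (Fin n → Bool) → Bool) (hsymm : ∀ x y, B x y = B y x)
    (hadd : ∀ x y z, B (bxor x y) z = (B x z ^^ B y z)) (b c : Fin 1 → (Fin n → Bool))
    (hbc : ∀ i, B (b i) (c i) = true) (hbc' : ∀ i j, i ≠ j → B (b i) (c j) = false)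
    (hbb : ∀ i j, B (b i) (b j) = false) (hcc : ∀ i j, B (c i) (c j) = false)
    (hmax : ∀ x y, (∀ i, B x (b i) = false) → (∀ i, B x (c i) = false) → (∀ i, B y (b i) = false) → (∀ i, B y (c i) = false) →
      B x y = false) (x y : Fin n → Bool) :
    B x y = ((B x (c 0) && B y (b 0)) ^^ (B x (b 0) && B y (c 0))) := by
  have e := tsc_form_expansion B hsymm hadd 1 b c hbc hbc' hbb hcc hmax x y
  rw [Fin.sum_univ_one] at e
  revert e
  cases B x y <;> cases B x (c 0) <;> cases B y (b 0) <;> cases B x (b 0) <;> cases B y (c 0) <;> decide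

/-- **Cell lemma L2 for `μ = 2` on 8 bits.**  Two quadratics whose forms differ by a form of rank `4` and with `#f₀ + #f₁ < 160` have
`B₀ ≡ 0`, or `B₁ ≡ 0`, or both forms of rank exactly `2` (product forms). [this work; cite: MacWilliamsSloane1977, Ch. 15 §2] -/
theorem tcl_halves_eight_mu2 (f₀ f₁ : (Fin 8 → Bool) → Bool) (B₀ B₁ : (Fin 8 → Bool) → (Fin 8 → Bool) → Bool)
    (hB₀ : ∀ v w x, ((f₀ x ^^ f₀ (bxor x w)) ^^ (f₀ (bxor x v) ^^ f₀ (bxor (bxor x v) w))) = B₀ v w)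
    (hB₁ : ∀ v w x, ((f₁ x ^^ f₁ (bxor x w)) ^^ (f₁ (bxor x v) ^^ f₁ (bxor (bxor x v) w))) = B₁ v w)
    (bω cω : Fin 2 → (Fin 8 → Bool))
    (hω1 : ∀ i, (B₀ (bω i) (cω i) ^^ B₁ (bω i) (cω i)) = true)
    (hω2 : ∀ i j, i ≠ j → (B₀ (bω i) (cω j) ^^ B₁ (bω i) (cω j)) = false)
    (hω3 : ∀ i j, (B₀ (bω i) (bω j) ^^ B₁ (bω i) (bω j)) = false)
    (hωmax : ∀ x y, (∀ i, (B₀ x (bω i) ^^ B₁ x (bω i)) = false) → (∀ i, (B₀ x (cω i) ^^ B₁ x (cω i)) = false) →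
      (∀ i, (B₀ y (bω i) ^^ B₁ y (bω i)) = false) → (∀ i, (B₀ y (cω i) ^^ B₁ y (cω i)) = false) → (B₀ x y ^^ B₁ x y) = false)
    (hlt : #(univ.filter fun x : Fin 8 → Bool => f₀ x = true) + #(univ.filter fun x : Fin 8 → Bool => f₁ x = true) < 160) :
    (∀ x y, B₀ x y = false) ∨ (∀ x y, B₁ x y = false) ∨
    ((∃ p q : Fin 8 → Bool, ∀ x y, B₀ x y = ((B₀ x q && B₀ y p) ^^ (B₀ x p && B₀ y q))) ∧
     (∃ p q : Fin 8 → Bool, ∀ x y, B₁ x y = ((B₁ x q && B₁ y p) ^^ (B₁ x p && B₁ y q)))) := by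
  obtain ⟨h₀, h₁, b₀, c₀, b₁, c₁, ⟨f01, f02, f03, f04, hmax₀⟩, ⟨f11, f12, f13, f14, hmax₁⟩, hsub, hle₀, hle₁, hD₀, hD₁⟩ :=
    tcl_halves_rank f₀ f₁ B₀ B₁ hB₀ hB₁ 2 bω cω hω1 hω2 hω3 hωmax
  by_cases hz₀ : h₀ = 0
  · left; subst hz₀
    exact fun x y => hmax₀ x y (fun i => Fin.elim0 i) (fun i => Fin.elim0 i) (fun i => Fin.elim0 i) (fun i => Fin.elim0 i)
  by_cases hz₁ : h₁ = 0
  · right; left; subst hz₁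
    exact fun x y => hmax₁ x y (fun i => Fin.elim0 i) (fun i => Fin.elim0 i) (fun i => Fin.elim0 i) (fun i => Fin.elim0 i)
  -- both ranks are positive: the weights force `h₀ = h₁ = 1`
  have hh₀ : h₀ ≤ 4 := by omega
  have hh₁ : h₁ ≤ 4 := by omega
  have h11 : h₀ = 1 ∧ h₁ = 1 := by
    interval_cases h₀ <;> interval_cases h₁ <;> simp only [Nat.reducePow, Nat.reduceSub] at hD₀ hD₁ <;> omega
  obtain ⟨rfl, rfl⟩ := h11
  -- symmetric / additive (from base-point freeness), then the product form
  have hsa : ∀ (f : (Fin 8 → Bool) → Bool) (B : (Fin 8 → Bool) → (Fin 8 → Bool) → Bool),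
      (∀ v w x, ((f x ^^ f (bxor x w)) ^^ (f (bxor x v) ^^ f (bxor (bxor x v) w))) = B v w) →
      (∀ v w, B v w = B w v) ∧ (∀ u v w, B (bxor u v) w = (B u w ^^ B v w)) := by
    intro f B hB
    refine ⟨fun v w => ?_, fun u v w => ?_⟩
    · rw [← hB v w zeroVec, ← hB w v zeroVec, iw_bxor_assoc, iw_bxor_assoc, bxor_comm v w]
      cases f zeroVec <;> cases f (bxor zeroVec w) <;> cases f (bxor zeroVec v) <;> cases f (bxor zeroVec (bxor w v)) <;> rfl
    · rw [← hB (bxor u v) w zeroVec, ← hB u w zeroVec, ← hB v w u]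
      simp only [zeroVec_bxor]
      cases f zeroVec <;> cases f w <;> cases f u <;> cases f (bxor u w) <;> cases f (bxor u v) <;>
        cases f (bxor (bxor u v) w) <;> rfl
  obtain ⟨hs₀, ha₀⟩ := hsa f₀ B₀ hB₀
  obtain ⟨hs₁, ha₁⟩ := hsa f₁ B₁ hB₁
  right; right
  exact ⟨⟨b₀ 0, c₀ 0, fun x y => tcl_rank_one_product B₀ hs₀ ha₀ b₀ c₀ f01 f02 f03 f04 hmax₀ x y⟩,
    ⟨b₁ 0, c₁ 0, fun x y => tcl_rank_one_product B₁ hs₁ ha₁ b₁ c₁ f11 f12 f13 f14 hmax₁ x y⟩⟩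

/-- **Weak form (`#f₀ + #f₁ < 192`)**: one of the two forms has a maximal frame of size `≤ 1` (rank `≤ 2`), given as: `B₀ ≡ 0`, `B₁ ≡ 0`, or a
product form for one of them. [this work] -/
theorem tcl_halves_eight_mu2_weak (f₀ f₁ : (Fin 8 → Bool) → Bool) (B₀ B₁ : (Fin 8 → Bool) → (Fin 8 → Bool) → Bool)
    (hB₀ : ∀ v w x, ((f₀ x ^^ f₀ (bxor x w)) ^^ (f₀ (bxor x v) ^^ f₀ (bxor (bxor x v) w))) = B₀ v w)
    (hB₁ : ∀ v w x, ((f₁ x ^^ f₁ (bxor x w)) ^^ (f₁ (bxor x v) ^^ f₁ (bxor (bxor x v) w))) = B₁ v w)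
    (bω cω : Fin 2 → (Fin 8 → Bool))
    (hω1 : ∀ i, (B₀ (bω i) (cω i) ^^ B₁ (bω i) (cω i)) = true)
    (hω2 : ∀ i j, i ≠ j → (B₀ (bω i) (cω j) ^^ B₁ (bω i) (cω j)) = false)
    (hω3 : ∀ i j, (B₀ (bω i) (bω j) ^^ B₁ (bω i) (bω j)) = false)
    (hωmax : ∀ x y, (∀ i, (B₀ x (bω i) ^^ B₁ x (bω i)) = false) → (∀ i, (B₀ x (cω i) ^^ B₁ x (cω i)) = false) →
      (∀ i, (B₀ y (bω i) ^^ B₁ y (bω i)) = false) → (∀ i, (B₀ y (cω i) ^^ B₁ y (cω i)) = false) → (B₀ x y ^^ B₁ x y) = false)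
    (hlt : #(univ.filter fun x : Fin 8 → Bool => f₀ x = true) + #(univ.filter fun x : Fin 8 → Bool => f₁ x = true) < 192) :
    (∀ x y, B₀ x y = false) ∨ (∀ x y, B₁ x y = false) ∨
    (∃ p q : Fin 8 → Bool, ∀ x y, B₀ x y = ((B₀ x q && B₀ y p) ^^ (B₀ x p && B₀ y q))) ∨
    (∃ p q : Fin 8 → Bool, ∀ x y, B₁ x y = ((B₁ x q && B₁ y p) ^^ (B₁ x p && B₁ y q))) := by
  obtain ⟨h₀, h₁, b₀, c₀, b₁, c₁, ⟨f01, f02, f03, f04, hmax₀⟩, ⟨f11, f12, f13, f14, hmax₁⟩, hsub, hle₀, hle₁, hD₀, hD₁⟩ :=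
    tcl_halves_rank f₀ f₁ B₀ B₁ hB₀ hB₁ 2 bω cω hω1 hω2 hω3 hωmax
  by_cases hz₀ : h₀ = 0
  · left; subst hz₀
    exact fun x y => hmax₀ x y (fun i => Fin.elim0 i) (fun i => Fin.elim0 i) (fun i => Fin.elim0 i) (fun i => Fin.elim0 i)
  by_cases hz₁ : h₁ = 0
  · right; left; subst hz₁
    exact fun x y => hmax₁ x y (fun i => Fin.elim0 i) (fun i => Fin.elim0 i) (fun i => Fin.elim0 i) (fun i => Fin.elim0 i)
  have hh₀ : h₀ ≤ 4 := by omega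
  have hh₁ : h₁ ≤ 4 := by omega
  have h11 : h₀ = 1 ∨ h₁ = 1 := by
    interval_cases h₀ <;> interval_cases h₁ <;> simp only [Nat.reducePow, Nat.reduceSub] at hD₀ hD₁ <;> omega
  have hsa : ∀ (f : (Fin 8 → Bool) → Bool) (B : (Fin 8 → Bool) → (Fin 8 → Bool) → Bool),
      (∀ v w x, ((f x ^^ f (bxor x w)) ^^ (f (bxor x v) ^^ f (bxor (bxor x v) w))) = B v w) →
      (∀ v w, B v w = B w v) ∧ (∀ u v w, B (bxor u v) w = (B u w ^^ B v w)) := by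
    intro f B hB
    refine ⟨fun v w => ?_, fun u v w => ?_⟩
    · rw [← hB v w zeroVec, ← hB w v zeroVec, iw_bxor_assoc, iw_bxor_assoc, bxor_comm v w]
      cases f zeroVec <;> cases f (bxor zeroVec w) <;> cases f (bxor zeroVec v) <;> cases f (bxor zeroVec (bxor w v)) <;> rfl
    · rw [← hB (bxor u v) w zeroVec, ← hB u w zeroVec, ← hB v w u]
      simp only [zeroVec_bxor]
      cases f zeroVec <;> cases f w <;> cases f u <;> cases f (bxor u w) <;> cases f (bxor u v) <;>
        cases f (bxor (bxor u v) w) <;> rfl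
  rcases h11 with h1 | h1
  · subst h1
    obtain ⟨hs₀, ha₀⟩ := hsa f₀ B₀ hB₀
    right; right; left
    exact ⟨b₀ 0, c₀ 0, fun x y => tcl_rank_one_product B₀ hs₀ ha₀ b₀ c₀ f01 f02 f03 f04 hmax₀ x y⟩
  · subst h1
    obtain ⟨hs₁, ha₁⟩ := hsa f₁ B₁ hB₁
    right; right; right
    exact ⟨b₁ 0, c₁ 0, fun x y => tcl_rank_one_product B₁ hs₁ ha₁ b₁ c₁ f11 f12 f13 f14 hmax₁ x y⟩

end Summit.QuantumAdvantage.QuantumAdvantage.Theorems.CubicForrelation.NearExactIsExact
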